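import Summits.NavierStokesRegularity.FunctionalMining.NoGo.SpiralJetProfiles
import HarnessLib

/-!
# K1-Q2 all-`q` kill-all, part 2: the spiral-jet field, its Jacobian, `div = 0`, `det S ≡ 0`, `λ₂ ≡ 0`

Search for candidate a priori estimates; no regularity claim. NS FUNCTIONAL MINING — NO-GO BRANCH
(cell `pub-nsfunc`, prove seat gen 13). In cube coordinates `y ∈ [0,1)³`, `p = y₀ − ½`,
`q = y₁ − ½`, `s = p² + q²`, the field is the tree's vertically modulated cut-off solid-body rotation
(`KillAll.U0`, `KillAll.U1`: `(−q, p)·gc(s)·Vz(y₂)`) plus the SPIRAL jet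
`J2(y) = kf(s)·(p·cf(s) − q·df(s)) = Bf(s)·cos(θ + ψf(s))` (polar angle `θ`; profiles of part 1),
supported in the annulus `1/128 < s < 15/128` inside the core `{gc = 1}`:
`sfld ξ = Gs (repr ξ)`. Proved, exactly as for the tree's Cartesian-jet witness
(`NoGo/MiddleEigenvalueKillAllField`): `sfld` is smooth (`isSmooth_sfld`) and divergence free
(`isDivFree_sfld`); its Jacobian in closed form (`partialDeriv_sfld`, `jacs`); the strain has trace
`0` and `det S ≡ 0` (`strain_det`: in the core the horizontal part is an exact rotation so
`S = [[0,0,a],[0,0,b],[a,b,0]]` WHATEVER the jet; outside the annulus the jet and its gradient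
vanish), hence `λ₂(S) ≡ 0` (`middle_eq_zero`). The jet's shape enters only through two scalar
densities `J2x`, `J2y` (its horizontal gradient). Nothing about Navier–Stokes is asserted.
-/

noncomputable section

open MeasureTheory Set Function Filter Topology Metric
open scoped ContDiff Real

namespace Summit.NavierStokesRegularity.FunctionalMining

namespace SpiralJet

open Literature.Analysis.FunctionSpaces Literature.Analysis.FunctionSpaces.Torus KillAll

/-! ## The spiral jet and the field on `ℝ³` -/

/-- The spiral jet `J2(y) = kf(s)(p·cf(s) − q·df(s))`, `s = p² + q²`. [ours] -/
def J2 (y : E3) : ℝ := kf (rs y) * (pc y * cf (rs y) - qc y * df (rs y))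

/-- The three components (swirl from the tree, spiral jet). [ours] -/
def Us : Fin 3 → E3 → ℝ := ![U0, U1, J2]

/-- The field on `ℝ³`. [ours] -/
def Gs : E3 → E3 := Sep3.vec3 Us

/-- **The spiral-jet witness field on `T³`.** [ours] -/
def sfld (ξ : UnitAddTorus (Fin 3)) : E3 := Gs (repr ξ)

/-- `Us 0 = U0`. [ours, bookkeeping] -/
@[simp] theorem Us_zero : Us 0 = U0 := rfl
/-- `Us 1 = U1`. [ours, bookkeeping] -/
@[simp] theorem Us_one : Us 1 = U1 := rfl
/-- `Us 2 = J2`. [ours, bookkeeping] -/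
@[simp] theorem Us_two : Us 2 = J2 := rfl

/-! ### Smoothness -/

/-- `J2` is smooth. [ours, bookkeeping] -/
theorem contDiff_J2 : ContDiff ℝ ∞ J2 :=
  (contDiff_kf.comp contDiff_rs).mul
    ((contDiff_pc.mul (contDiff_cf.comp contDiff_rs)).sub (contDiff_qc.mul (contDiff_df.comp contDiff_rs)))

/-- Every component is smooth. [ours, bookkeeping] -/
theorem contDiff_Us (i : Fin 3) : ContDiff ℝ ∞ (Us i) := by
  fin_cases i
  · exact contDiff_U0
  · exact contDiff_U1
  · exact contDiff_J2

/-- Every component is differentiable. [ours, bookkeeping] -/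
theorem differentiable_Us (i : Fin 3) : Differentiable ℝ (Us i) :=
  (contDiff_Us i).differentiable (by simp)

/-- `Gs` is smooth. [ours, bookkeeping] -/
theorem contDiff_Gs : ContDiff ℝ ∞ Gs := Sep3.contDiff_vec3 contDiff_Us

/-! ### Vertical periodicity and vanishing near the vertical faces -/

/-- `J2` does not see `y₂`. [ours, bookkeeping] -/
theorem J2_add_e2 (y : E3) : J2 (y + EuclideanSpace.single 2 1) = J2 y := by
  simp only [J2, pc_add_e2, qc_add_e2, rs_add_e2]

/-- Vertical `1`-periodicity of the components. [ours, bookkeeping] -/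
theorem Us_add_e2 (i : Fin 3) (y : E3) : Us i (y + EuclideanSpace.single 2 1) = Us i y := by
  fin_cases i
  · exact U_add_e2 0 y
  · exact U_add_e2 1 y
  · exact J2_add_e2 y

/-- Vertical `1`-periodicity of `Gs`. [ours, bookkeeping] -/
theorem Gs_add_e2 (y : E3) : Gs (y + EuclideanSpace.single 2 1) = Gs y := by
  ext i
  simp only [Gs, Sep3.vec3_apply, Us_add_e2]

/-- Near the vertical faces the radius is large (`s ≥ 7/32`), so the jet amplitude vanishes:
`kf(s) = 0` and `kf′(s) = 0`. [ours, bookkeeping] -/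
theorem kf_rs_eq_zero {y : E3}
    (h : y 0 ≤ 1 / 64 ∨ 1 - 1 / 64 ≤ y 0 ∨ y 1 ≤ 1 / 64 ∨ 1 - 1 / 64 ≤ y 1) :
    kf (rs y) = 0 ∧ deriv kf (rs y) = 0 := by
  have hrs : 7 / 32 ≤ rs y := by
    unfold rs pc qc sh
    rcases h with h | h | h | h <;> nlinarith [sq_nonneg (y 0 - 1 / 2), sq_nonneg (y 1 - 1 / 2)]
  have hout : 7 / 128 ≤ |rs y - 1 / 16| := by
    rw [abs_of_nonneg (by linarith)]; linarith
  exact ⟨kf_eq_zero_of_out hout, dkf_eq_zero_of_out hout⟩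

/-- The components vanish near the vertical faces. [ours, bookkeeping] -/
theorem Us_eq_zero_near_faces (i : Fin 3) (y : E3)
    (h : y 0 ≤ 1 / 64 ∨ 1 - 1 / 64 ≤ y 0 ∨ y 1 ≤ 1 / 64 ∨ 1 - 1 / 64 ≤ y 1) : Us i y = 0 := by
  fin_cases i
  · exact U_eq_zero_near_faces 0 y h
  · exact U_eq_zero_near_faces 1 y h
  · show J2 y = 0
    simp [J2, (kf_rs_eq_zero h).1]

/-- `Gs` vanishes near the vertical faces. [ours, bookkeeping] -/
theorem Gs_eq_zero_near_faces (y : E3)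
    (h : y 0 ≤ 1 / 64 ∨ 1 - 1 / 64 ≤ y 0 ∨ y 1 ≤ 1 / 64 ∨ 1 - 1 / 64 ≤ y 1) : Gs y = 0 := by
  ext i
  simp only [Gs, Sep3.vec3_apply, Us_eq_zero_near_faces i y h]
  rfl

/-- **The spiral-jet field is smooth on `T³`.** [ours] -/
theorem isSmooth_sfld : IsSmooth sfld :=
  isSmooth_comp_repr contDiff_Gs Gs_add_e2 (by norm_num : (0 : ℝ) < 1 / 64) Gs_eq_zero_near_faces

/-! ### The Jacobian in closed form -/

/-- `(EuclideanSpace.proj a) v = v a`. [folklore] -/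
private theorem proj_apply' (a : Fin 3) (v : E3) : (EuclideanSpace.proj a : E3 →L[ℝ] ℝ) v = v a :=
  rfl

/-- The `x`-derivative density of the jet:
`J2x = 2p·kf′(s)(p cf − q df) + kf(s)(cf − 2p ψf′(s)(p df + q cf))`. [ours] -/
def J2x (y : E3) : ℝ :=
  2 * pc y * deriv kf (rs y) * (pc y * cf (rs y) - qc y * df (rs y)) +
    kf (rs y) * (cf (rs y) - 2 * pc y * deriv ψf (rs y) * (pc y * df (rs y) + qc y * cf (rs y)))

/-- The `y`-derivative density of the jet:
`J2y = 2q·kf′(s)(p cf − q df) + kf(s)(−df − 2q ψf′(s)(p df + q cf))`. [ours] -/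
def J2y (y : E3) : ℝ :=
  2 * qc y * deriv kf (rs y) * (pc y * cf (rs y) - qc y * df (rs y)) +
    kf (rs y) * (-df (rs y) - 2 * qc y * deriv ψf (rs y) * (pc y * df (rs y) + qc y * cf (rs y)))

/-- `D(kf ∘ s)(y)`. [ours, bookkeeping] -/
theorem hasFDerivAt_kf_rs (y : E3) : HasFDerivAt (fun y => kf (rs y))
    (deriv kf (rs y) • (pc y • (EuclideanSpace.proj 0 : E3 →L[ℝ] ℝ) +
      pc y • (EuclideanSpace.proj 0 : E3 →L[ℝ] ℝ) +
      (qc y • (EuclideanSpace.proj 1 : E3 →L[ℝ] ℝ) + qc y • (EuclideanSpace.proj 1 : E3 →L[ℝ] ℝ))))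
    y :=
  (differentiable_kf _).hasDerivAt.comp_hasFDerivAt y (hasFDerivAt_rs y)

/-- `D(cf ∘ s)(y)`. [ours, bookkeeping] -/
theorem hasFDerivAt_cf_rs (y : E3) : HasFDerivAt (fun y => cf (rs y))
    ((-(df (rs y) * deriv ψf (rs y))) • (pc y • (EuclideanSpace.proj 0 : E3 →L[ℝ] ℝ) +
      pc y • (EuclideanSpace.proj 0 : E3 →L[ℝ] ℝ) +
      (qc y • (EuclideanSpace.proj 1 : E3 →L[ℝ] ℝ) + qc y • (EuclideanSpace.proj 1 : E3 →L[ℝ] ℝ))))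
    y :=
  (hasDerivAt_cf (rs y)).comp_hasFDerivAt y (hasFDerivAt_rs y)

/-- `D(df ∘ s)(y)`. [ours, bookkeeping] -/
theorem hasFDerivAt_df_rs (y : E3) : HasFDerivAt (fun y => df (rs y))
    ((cf (rs y) * deriv ψf (rs y)) • (pc y • (EuclideanSpace.proj 0 : E3 →L[ℝ] ℝ) +
      pc y • (EuclideanSpace.proj 0 : E3 →L[ℝ] ℝ) +
      (qc y • (EuclideanSpace.proj 1 : E3 →L[ℝ] ℝ) + qc y • (EuclideanSpace.proj 1 : E3 →L[ℝ] ℝ))))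
    y :=
  (hasDerivAt_df (rs y)).comp_hasFDerivAt y (hasFDerivAt_rs y)

/-- `DJ2(y) v = v₀ J2x(y) + v₁ J2y(y)`. [ours] -/
theorem fderiv_J2 (y v : E3) : fderiv ℝ J2 y v = v 0 * J2x y + v 1 * J2y y := by
  have h := (hasFDerivAt_kf_rs y).mul
    (((hasFDerivAt_pc y).mul (hasFDerivAt_cf_rs y)).sub ((hasFDerivAt_qc y).mul (hasFDerivAt_df_rs y)))
  rw [show J2 = ((fun y => kf (rs y)) * (pc * (fun y => cf (rs y)) - qc * fun y => df (rs y)))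
    from by funext y; rfl, h.fderiv]
  simp only [Pi.mul_apply, Pi.sub_apply, _root_.add_apply, _root_.sub_apply, _root_.smul_apply,
    smul_eq_mul, proj_apply', J2x, J2y]
  ring

/-- The Jacobian `jacs y i j = ∂ᵢ (Gs)ⱼ (y)` in closed form. [ours] -/
def jacs (y : E3) : Matrix (Fin 3) (Fin 3) ℝ :=
  !![-(qc y * (deriv gc (rs y) * (2 * pc y)) * Vz (y 2)),
      (gc (rs y) + pc y * (deriv gc (rs y) * (2 * pc y))) * Vz (y 2),
      J2x y;
    -((gc (rs y) + qc y * (deriv gc (rs y) * (2 * qc y))) * Vz (y 2)),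
      pc y * (deriv gc (rs y) * (2 * qc y)) * Vz (y 2),
      J2y y;
    -(qc y * gc (rs y) * dVz (y 2)), pc y * gc (rs y) * dVz (y 2), 0]

/-- `DUsⱼ(y) eᵢ = jacs y i j`. [ours, bookkeeping] -/
theorem fderiv_Us_single (y : E3) (i j : Fin 3) :
    fderiv ℝ (Us j) y (EuclideanSpace.single i 1) = jacs y i j := by
  fin_cases i <;> fin_cases j <;>
    simp [fderiv_U0, fderiv_U1, fderiv_J2, jacs]

/-- **Partial derivatives of the witness**: `(∂ᵢ sfld)(ξ)ⱼ = jacs (repr ξ) i j`. [ours] -/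
theorem partialDeriv_sfld (i j : Fin 3) (ξ : UnitAddTorus (Fin 3)) :
    Torus.partialDeriv i sfld ξ j = jacs (repr ξ) i j := by
  have h := partialDeriv_comp_repr contDiff_Gs Gs_add_e2 (by norm_num : (0 : ℝ) < 1 / 64)
    Gs_eq_zero_near_faces i ξ
  rw [show sfld = fun x => Gs (repr x) from rfl, h, Gs, Sep3.fderiv_vec3_apply differentiable_Us,
    fderiv_Us_single]

/-- Partial derivatives of the components: `∂ᵢ (sfld · j)(ξ) = jacs (repr ξ) i j`. [ours] -/
theorem partialDeriv_sfld_apply (i j : Fin 3) (ξ : UnitAddTorus (Fin 3)) :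
    Torus.partialDeriv i (fun x => sfld x j) ξ = jacs (repr ξ) i j := by
  have h := partialDeriv_comp_repr (contDiff_Us j) (Us_add_e2 j) (by norm_num : (0 : ℝ) < 1 / 64)
    (Us_eq_zero_near_faces j) i ξ
  rw [show (fun x => sfld x j) = fun x => Us j (repr x) from rfl, h, fderiv_Us_single]

/-! ### Divergence, strain, middle eigenvalue -/

/-- **The witness is divergence free.** [ours] -/
theorem isDivFree_sfld : IsDivFree sfld := fun ξ => by
  simp only [Torus.divergence, Fin.sum_univ_three, partialDeriv_sfld_apply, jacs]
  simp
  ring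

/-- In the core `s ≤ 3/16` the cut-off is identically `1`: `gc(s) = 1`, `gc′(s) = 0`. [ours] -/
theorem core_of_le {y : E3} (h : rs y ≤ 3 / 16) : gc (rs y) = 1 ∧ deriv gc (rs y) = 0 := by
  have hnn : 0 ≤ rs y := by unfold rs; nlinarith [sq_nonneg (pc y), sq_nonneg (qc y)]
  have hs : |rs y| ≤ 3 / 16 := by rw [abs_of_nonneg hnn]; exact h
  exact ⟨gc_eq_one hs, dgc_eq_zero hs⟩

/-- Outside the core (`3/16 < s`) the jet and its gradient vanish: `kf(s) = kf′(s) = 0`, hence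
`J2x = J2y = 0`. [ours] -/
theorem jet_of_lt {y : E3} (h : 3 / 16 < rs y) : J2x y = 0 ∧ J2y y = 0 := by
  have hout : 7 / 128 ≤ |rs y - 1 / 16| := by
    rw [abs_of_nonneg (by linarith)]; linarith
  simp [J2x, J2y, kf_eq_zero_of_out hout, dkf_eq_zero_of_out hout]

/-- The strain matrix of the witness at `ξ`. [ours] -/
def strain (ξ : UnitAddTorus (Fin 3)) : Matrix (Fin 3) (Fin 3) ℝ :=
  Matrix.of fun i j => (Torus.partialDeriv j sfld ξ i + Torus.partialDeriv i sfld ξ j) / 2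

/-- The strain is symmetric. [ours, bookkeeping] -/
theorem strain_isSymm (ξ : UnitAddTorus (Fin 3)) : (strain ξ).IsSymm := by
  ext i j
  simp only [strain, Matrix.transpose_apply, Matrix.of_apply]
  ring

/-- The strain is trace free. [ours, bookkeeping] -/
theorem strain_trace (ξ : UnitAddTorus (Fin 3)) : (strain ξ).trace = 0 := by
  simp only [strain, Matrix.trace_fin_three, Matrix.of_apply, partialDeriv_sfld, jacs]
  simp
  ring

/-- **`det S ≡ 0`** for the spiral-jet witness (two cases: the core, where the horizontal part is an
exact solid-body rotation and `S = [[0,0,a],[0,0,b],[a,b,0]]` for ANY jet; or outside the core, where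
the jet's gradient vanishes). [ours] -/
theorem strain_det (ξ : UnitAddTorus (Fin 3)) : (strain ξ).det = 0 := by
  simp only [strain, Matrix.det_fin_three, Matrix.of_apply, partialDeriv_sfld, jacs]
  simp
  set y := repr ξ
  rcases le_or_gt (rs y) (3 / 16) with h | h
  · obtain ⟨h1, h0⟩ := core_of_le h
    rw [h1, h0]; ring
  · obtain ⟨hx, hy⟩ := jet_of_lt h
    rw [hx, hy]; ring

/-- **`λ₂(S) = 0` everywhere** for the spiral-jet witness. [ours] -/
theorem middle_eq_zero (ξ : UnitAddTorus (Fin 3)) (hx : (strain ξ).IsHermitian) :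
    hx.eigenvalues₀ (Fin.cast (Fintype.card_fin 3).symm 1) = 0 :=
  MiddleEigen.middle_eq_zero_of_det_eq_zero (Fintype.card_fin 3) (strain ξ) (strain_isSymm ξ)
    (strain_trace ξ) (strain_det ξ)

/-- The middle strain eigenvalue of the witness is `≤ 0` everywhere (it is `= 0`), in the form the
door `middleEigenvalueMomentRateFailsReal_of_nonpos_middle` expects. [ours] -/
theorem middle_nonpos_sfld : ∀ x : UnitAddTorus (Fin 3), ∀ hx : (Matrix.of fun i j =>
    (Torus.partialDeriv j sfld x i + Torus.partialDeriv i sfld x j) / 2).IsHermitian,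
    hx.eigenvalues₀ (Fin.cast (Fintype.card_fin 3).symm 1) ≤ 0 := fun x hx =>
  (middle_eq_zero x hx).le

end SpiralJet

end Summit.NavierStokesRegularity.FunctionalMining

end
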